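import Literature.MathematicalPhysics.QuantumFieldTheory.Balaban1983to89.Node00.HistoryTermsOfRecord
import Literature.MathematicalPhysics.QuantumFieldTheory.Balaban1983to89.Node00.U3OfKernels

/-!
# NODE 00 ∕ W1 — THE (1.7) LOCALIZED SUM: [I] (1.7) ∕ [II] (2.14) AS THE JUNCTION BETWEEN THE W1 READING'S TOWERS OF (2.13) TERMS
# AND A TERM FAMILY `Node00.TermFamily1`, with the ESTIMATE-FREE transfer to node U3's kernel objects `Node00.U3OfKernels`

Seat `pub-ymgap-node00-def-W1` g29 (DEFINER; object W1 = [Balaban1988RG2Cluster] §2 (2.13)–(2.14) on the torus catalogue of record; Literature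
side, hypothesis-schema style, D-0064 one file per source section).  Plan ruling of record (seat `pub-ymgap-plan` g81, 2026-08-28): node U3's object
OF RECORD is `U3OfKernels.objectsOfRecord₁₃` — the LIMITING (1.21) kernels of the merged term family of record —, while the W1 reading
(`Node00.W1.ReadingData`, its towers `D.S K : W1.ClusterTower (F.P K) 𝔸 M`) carries the FINITE-VOLUME (2.13) terms run by run; this storey
types the one printed identity that joins the two, as a LAW (a `Prop`, displayed by consumers, inhabited by nobody today), and proves what follows
from it WITHOUT any estimate.

## Print

[I] (1.7) p. 261: «E^{(j)}(g_{j−1}, U_j) = Σ_{X∈D_j} E^{(j)}(X, g_{j−1}, U_j)» — the localized representation of the history-dependent term of the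
effective action; [II] (2.14) p. 15 is the same sum for the terms (2.13) produced by the cluster expansion («E^{(k+1)} = Σ_{X∈𝐃_{k+1}} E^{(k+1)}(X)»).
[I] p. 264, after (1.20)–(1.21): «Now we take a limit of these functions as T^{(j+1)} ↗ Z^d. This limit exists by the localized representation
(1.7)» — the kernels of record are limits over the run length `K` of kernels of THESE finite-volume sums.

## Contents

* §1 **`localizedSum F S emb : Node00.TermFamily1 F 𝔄`** — for a family of towers `S : (K : ℕ) → W1.ClusterTower (F.P K) 𝔸 M` (one tower per
  run length `K`, on the `K`-th torus, exactly the field `ReadingData.S`) and READING MAPS `emb : ReadingMaps F 𝔄 𝔸` (the level-`(k+1)` probe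
  field `W` of the `K`-th torus ↦ a complex configuration pair `Sect2.CPair (F.P K) 𝔸`; OF RECORD this is the minimizer `U_{k+1}(·)` of the
  β-layer transport followed by the pair reading — a PARAMETER here, as `embA` is in `W1.LevelPairing`): the functional
  `(k, hist, K, W) ↦ Σ_{X ∈ 𝐃_{k+1}(T_K)} Re E^{(k+1)}(X; hist; emb W)` — print's right-hand side of (1.7) at finite volume, the sum over the
  fibre `(Sect2.domSys (F.P K) M (k+1)).Dom` of scale-`(k+1)` localization domains of the `K`-th torus of W1's terms `W1.ClusterStep.E`.
  Faces: `localizedSum_apply` (rfl); `localizedSum_histPrefix` (rfl — at the cut history `U3OfKernels.histPrefix g k` the summand is W1-14's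
  `W1.functionalC (S K) g (emb K k W) ⟨k+1, X⟩`, the currency of the reading-level producers).
* §2 **THE LAW `Localizes17 F S emb ℰ : Prop`** := `∀ k hist K, k + 1 ≤ K → ℰ k hist K = localizedSum F S emb k hist K` (the term family IS
  the localized sum from the run length at which the level exists on; the guard `k + 1 ≤ K` is print's «T^{(k+1)}» of the `K`-th approximation);
  the unguarded form `Localizes17All`; `EventuallyAgree F ℰ ℰ'` (two term families agree for all large `K`, level by level) with `refl ∕ symm ∕
  trans`; `Localizes17.eventuallyAgree`.
* §3 **ESTIMATE-FREE TRANSFER**: `polLimit_congr_of_eventually` — `Node00.polLimit` (a `limUnder atTop`) of two EVENTUALLY EQUAL `K`-families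
  agree (`Filter.map_congr`; NO convergence is used or claimed); hence `kernelA ∕ kernelB ∕ EA ∕ EB ∕ objects` of `U3OfKernels` agree for
  eventually-agreeing term families (`…_congr_of_eventuallyAgree`), ★ `objects_eq_objects_localizedSum_of` (under the law, node U3's kernel
  objects of `ℰ` ARE the kernel objects of the reading's localized sum), `kernelDecay_iff_of_eventuallyAgree` (the (5.10) binder transfers), and
  the finite-volume DICTIONARY `kernelA_localizedSum` (rfl-grade): the kernel of the localized sum at level `k` is the (1.21)-limit of the
  polarized X-sum of W1-14's `functionalC` over the scale-`(k+1)` fibre — the face a walker from the reading-level producers to the kernel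
  objects cites.
* §4 **AT THE RECORD, Stage 13**: `Localizes17OfRecord₁₃ F N θ S emb` := the law for the MERGED TERM FAMILY OF RECORD `mergedTermFamilyMatT F N
  (TβOfRecord₁₃ F N) (chiβOfRecord₁₃ F N θ) θ.εbg`; `objectsOfReading₁₃ F N θ S emb ℓ` := node U3's KERNEL OBJECTS OF THE W1 READING at the
  record's β-chart `θ.ρ8 ∕ θ.bV` (instances bound by `letI`, exactly as in `U3OfKernels.objectsOfRecord₁₃`); ★★ `objectsOfRecord₁₃_eq_objects_localizedSum_of`
  — under the law `objectsOfRecord₁₃ F N θ ℓ = objectsOfReading₁₃ F N θ S emb ℓ`; ★★ `iff_of_localizes17OfRecord₁₃ (P : U3Objects₁₁ → Prop)` — EVERY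
  predicate of node U3's objects (the Summit side's K4 slots `N22At ∕ N18At ∕ ReadOutAt`, the guards `KeyedLive ∕ SensitiveOnBoxes`, …) holds at
  the objects of record iff it holds at the kernel objects of the reading; `kernelDecayOfRecord₁₃_iff_of_localizes` (the (D4) letter of record
  `U3OfKernels.KernelDecayOfRecord₁₃` read at the reading).

## HONEST LIMITS

Hypothesis-schema style: an OBJECT (`localizedSum`), a LAW (`Localizes17`, a `Prop`) and their definitional ∕ `limUnder`-congruence faces;
NOTHING of print's data is asserted.  The law's inhabitant at the record — that the merged term family of the RG-defined actions IS the
localized sum of the cluster expansion's terms, [II] Lemmas 1–3 with [I] §1 — is the CONTENT of the cluster-expansion nodes (NODE A ∕ N10 of the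
programme's DAG) and nobody's theorem today.  The transfer §3 is bookkeeping: equal inputs from some `K` on give equal `limUnder`s, whether or
not the limit (1.21) exists (its existence stays the displayed hypothesis `Node00.PolLimitExists` of the β-layer, [I] p. 264).  This file does
NOT carry any estimate from the finite-volume functionals to the limiting kernels: that the (1.18) decay, uniform in `K`, survives `K → ∞` is
[I] §1 ∕ (5.10) ESTIMATE content (prover lane, node N22 ∕ NODE O), not typed here.  Count-neutral; no node of the record is discharged; no
inhabitant of the record is claimed; one finite-torus programme at fixed lattice spacing — nothing continuum, nothing about a mass gap.

## CITATION HEADER (D-0065)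
- [I] = T. Bałaban, Renormalization group approach to lattice gauge field theories. I. Generation of effective actions in a small field
  approximation and a coupling constant renormalization in four dimensions, Comm. Math. Phys. 109 (1987) 249–301 [Balaban1987RG1]: (1.7) p. 261
  (quoted above); (1.20)–(1.21) p. 264 (quoted above); (2.13) p. 268 (the history-dependent term as a functional of a free history); (5.10) p. 293.
- [II] = T. Bałaban, Renormalization group approach to lattice gauge field theories. II. Cluster expansions, Comm. Math. Phys. 116 (1988) 1–22
  [Balaban1988RG2Cluster]: (2.13) p. 14, (2.14) p. 15 (the terms `E^{(k+1)}(X)` and their sum — the object W1 of this seat).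
- Pages read from the materialised text `paper:balaban1987-cmp109-rg-i-small-field` pp. 261, 264 (journal pagination; PDF pp. 13, 16) this
  generation; [II] pp. 14–15 in the seat's earlier generations (lineage HANDOFF).

Typer lint: no `instance`, no `notation`, no attribute removal, no `sorry`; imports `Node00.HistoryTermsOfRecord` (W1's towers) and
`Node00.U3OfKernels` (node U3's kernel objects) only; nothing re-declared.
-/

open scoped BigOperators

namespace Literature.MathematicalPhysics.QuantumFieldTheory.Balaban1983to89.Node00.LocalizedSum17

open Filter
open T4Continuum (T4Family)
open T4OutputRate (Window)
open Sect2 (domSys CPair)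
open W1 (ClusterStep ClusterTower functionalC)

/-! ## §1. The localized sum of a family of towers, read through reading maps -/

section Object

variable {𝔸 : Type*} {𝔄 : Type*} {M : ℕ} (F : T4Family)

/-- **READING MAPS** (a PARAMETER shape): for every run length `K` and level `k`, the level-`(k+1)` probe field `W` of the `K`-th torus
(the argument of a `Node00.TermFamily1`, [I] (1.20) p. 264: `U_{k+1}(exp iB)`) ↦ a complex configuration pair `(𝐔, 𝐉)` on the `K`-th torus
(the argument of W1's terms).  Of record: the β-layer's minimizer followed by the pair reading; NOT constructed here. [cite: Balaban1987RG1, (1.20) p.264 and (1.9) p.262] -/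
abbrev ReadingMaps (F : T4Family) (𝔄 𝔸 : Type*) : Type _ :=
  (K k : ℕ) → ((Fin (F.P K).d → Site (F.P K) (k + 1) → 𝔄)) → CPair (F.P K) 𝔸

/-- **THE (1.7) ∕ (2.14) LOCALIZED SUM AT FINITE VOLUME** as a term family: at level `k`, history `hist = (g_0, …, g_k)`, run length `K` and
probe field `W`, the sum over the scale-`(k+1)` localization domains `X ∈ 𝐃_{k+1}` of the `K`-th torus of `Re E^{(k+1)}(X; hist; emb W)` —
W1's (2.13) terms `W1.ClusterStep.E` of the tower `S K`. [cite: Balaban1987RG1, (1.7) p.261; Balaban1988RG2Cluster, (2.14) p.15] -/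
noncomputable def localizedSum (S : (K : ℕ) → ClusterTower (F.P K) 𝔸 M) (emb : ReadingMaps F 𝔄 𝔸) : TermFamily1 F 𝔄 :=
  fun k hist K W => ∑ X : (domSys (F.P K) M (k + 1)).Dom, (((S K) k).E hist (emb K k W) X).re

/-- Face (`rfl`): the localized sum unfolded. [cite: Balaban1987RG1, (1.7) p.261 (bookkeeping)] -/
theorem localizedSum_apply (S : (K : ℕ) → ClusterTower (F.P K) 𝔸 M) (emb : ReadingMaps F 𝔄 𝔸) (k : ℕ) (hist : Fin (k + 1) → ℝ)
    (K : ℕ) (W : Fin (F.P K).d → Site (F.P K) (k + 1) → 𝔄) :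
    localizedSum F S emb k hist K W = ∑ X : (domSys (F.P K) M (k + 1)).Dom, (((S K) k).E hist (emb K k W) X).re := rfl

/-- Face (`rfl`) — THE READING-LEVEL CURRENCY: at the cut history `histPrefix g k = (g_0, …, g_k)` of a coupling sequence `g` the summand is
W1's history functional `W1.functionalC (S K) g (emb K k W) ⟨k+1, X⟩` (`Node00/HistoryTermsOfRecord`; the value the reading-level objects
`W1.ReadingData.u3Objects` store, `u3Objects_EA_apply`). [cite: Balaban1988RG2Cluster, (2.13) p.14 and (2.14) p.15 (bookkeeping)] -/
theorem localizedSum_histPrefix (S : (K : ℕ) → ClusterTower (F.P K) 𝔸 M) (emb : ReadingMaps F 𝔄 𝔸) (g : ℕ → ℝ) (k K : ℕ)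
    (W : Fin (F.P K).d → Site (F.P K) (k + 1) → 𝔄) :
    localizedSum F S emb k (U3OfKernels.histPrefix g k) K W =
      ∑ X : (domSys (F.P K) M (k + 1)).Dom, (functionalC (S K) g (emb K k W) ⟨k + 1, X⟩).re := rfl

/-- The summand does not depend on the coupling sequence beyond its prefix `(g_0, …, g_k)` — BY TYPING. [cite: Balaban1987RG1, §0 p.256 (bookkeeping)] -/
theorem localizedSum_histPrefix_congr (S : (K : ℕ) → ClusterTower (F.P K) 𝔸 M) (emb : ReadingMaps F 𝔄 𝔸) {g g' : ℕ → ℝ} {k : ℕ}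
    (h : ∀ i < k + 1, g i = g' i) (K : ℕ) :
    localizedSum F S emb k (U3OfKernels.histPrefix g k) K = localizedSum F S emb k (U3OfKernels.histPrefix g' k) K := by
  rw [U3OfKernels.histPrefix_congr h]

/-! ## §2. The law (1.7): a term family IS the localized sum of the reading's towers -/

/-- **THE LAW (1.7) ∕ (2.14)** for a term family `ℰ`, a family of towers `S` and reading maps `emb`: from the run length `K ≥ k + 1` on (the
level-`(k+1)` lattice `T^{(k+1)}` of the `K`-th approximation exists) the level-`k` functional of `ℰ` IS the localized sum.  A DISPLAYED
HYPOTHESIS: its inhabitant at the record is the content of the cluster expansion ([II] Lemmas 1–3), NOT asserted.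
[cite: Balaban1987RG1, (1.7) p.261; Balaban1988RG2Cluster, (2.14) p.15] -/
def Localizes17 (S : (K : ℕ) → ClusterTower (F.P K) 𝔸 M) (emb : ReadingMaps F 𝔄 𝔸) (ℰ : TermFamily1 F 𝔄) : Prop :=
  ∀ k (hist : Fin (k + 1) → ℝ) K, k + 1 ≤ K → ℰ k hist K = localizedSum F S emb k hist K

/-- The UNGUARDED form of the law (all run lengths `K`). [cite: Balaban1987RG1, (1.7) p.261] -/
def Localizes17All (S : (K : ℕ) → ClusterTower (F.P K) 𝔸 M) (emb : ReadingMaps F 𝔄 𝔸) (ℰ : TermFamily1 F 𝔄) : Prop :=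
  ∀ k (hist : Fin (k + 1) → ℝ) K, ℰ k hist K = localizedSum F S emb k hist K

/-- Face (`Iff.rfl`). [cite: Balaban1987RG1, (1.7) p.261 (bookkeeping)] -/
theorem localizes17_iff (S : (K : ℕ) → ClusterTower (F.P K) 𝔸 M) (emb : ReadingMaps F 𝔄 𝔸) (ℰ : TermFamily1 F 𝔄) :
    Localizes17 F S emb ℰ ↔ ∀ k (hist : Fin (k + 1) → ℝ) K, k + 1 ≤ K → ℰ k hist K = localizedSum F S emb k hist K := Iff.rfl

/-- Face (`Iff.rfl`). [cite: Balaban1987RG1, (1.7) p.261 (bookkeeping)] -/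
theorem localizes17All_iff (S : (K : ℕ) → ClusterTower (F.P K) 𝔸 M) (emb : ReadingMaps F 𝔄 𝔸) (ℰ : TermFamily1 F 𝔄) :
    Localizes17All F S emb ℰ ↔ ∀ k (hist : Fin (k + 1) → ℝ) K, ℰ k hist K = localizedSum F S emb k hist K := Iff.rfl

/-- The unguarded law gives the guarded one. [cite: Balaban1987RG1, (1.7) p.261 (bookkeeping)] -/
theorem Localizes17All.localizes17 {S : (K : ℕ) → ClusterTower (F.P K) 𝔸 M} {emb : ReadingMaps F 𝔄 𝔸} {ℰ : TermFamily1 F 𝔄}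
    (h : Localizes17All F S emb ℰ) : Localizes17 F S emb ℰ := fun k hist K _ => h k hist K

/-- The localized sum localizes to itself (`rfl`) — the law is INHABITED at `ℰ := localizedSum F S emb` (no content: a consistency face).
[cite: Balaban1987RG1, (1.7) p.261 (bookkeeping)] -/
theorem localizes17All_localizedSum (S : (K : ℕ) → ClusterTower (F.P K) 𝔸 M) (emb : ReadingMaps F 𝔄 𝔸) :
    Localizes17All F S emb (localizedSum F S emb) := fun _ _ _ => rfl

/-- Consistency face: the guarded law at `ℰ := localizedSum F S emb`. [cite: Balaban1987RG1, (1.7) p.261 (bookkeeping)] -/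
theorem localizes17_localizedSum (S : (K : ℕ) → ClusterTower (F.P K) 𝔸 M) (emb : ReadingMaps F 𝔄 𝔸) :
    Localizes17 F S emb (localizedSum F S emb) := (localizes17All_localizedSum F S emb).localizes17 F

/-- **EVENTUAL AGREEMENT IN THE RUN LENGTH** of two term families: level by level and history by history, `ℰ k hist K = ℰ' k hist K` for all
large `K` — all that the limit (1.21) over `K → ∞` can see. [cite: Balaban1987RG1, (1.21) p.264] -/
def EventuallyAgree (ℰ ℰ' : TermFamily1 F 𝔄) : Prop :=
  ∀ k (hist : Fin (k + 1) → ℝ), ∃ K₀, ∀ K, K₀ ≤ K → ℰ k hist K = ℰ' k hist K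

/-- Face (`Iff.rfl`). [cite: Balaban1987RG1, (1.21) p.264 (bookkeeping)] -/
theorem eventuallyAgree_iff (ℰ ℰ' : TermFamily1 F 𝔄) :
    EventuallyAgree F ℰ ℰ' ↔ ∀ k (hist : Fin (k + 1) → ℝ), ∃ K₀, ∀ K, K₀ ≤ K → ℰ k hist K = ℰ' k hist K := Iff.rfl

/-- Eventual agreement is reflexive. [cite: Balaban1987RG1, (1.21) p.264 (bookkeeping)] -/
theorem eventuallyAgree_refl (ℰ : TermFamily1 F 𝔄) : EventuallyAgree F ℰ ℰ := fun _ _ => ⟨0, fun _ _ => Eq.refl _⟩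

/-- Eventual agreement is symmetric. [cite: Balaban1987RG1, (1.21) p.264 (bookkeeping)] -/
theorem EventuallyAgree.symm {ℰ ℰ' : TermFamily1 F 𝔄} (h : EventuallyAgree F ℰ ℰ') : EventuallyAgree F ℰ' ℰ := fun k hist => by
  obtain ⟨K₀, hK⟩ := h k hist
  exact ⟨K₀, fun K hKK => (hK K hKK).symm⟩

/-- Eventual agreement is transitive. [cite: Balaban1987RG1, (1.21) p.264 (bookkeeping)] -/
theorem EventuallyAgree.trans {ℰ ℰ' ℰ'' : TermFamily1 F 𝔄} (h : EventuallyAgree F ℰ ℰ') (h' : EventuallyAgree F ℰ' ℰ'') :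
    EventuallyAgree F ℰ ℰ'' := fun k hist => by
  obtain ⟨K₀, hK⟩ := h k hist
  obtain ⟨K₁, hK'⟩ := h' k hist
  exact ⟨max K₀ K₁, fun K hKK => (hK K (le_of_max_le_left hKK)).trans (hK' K (le_of_max_le_right hKK))⟩

/-- The unguarded law is eventual agreement from `K₀ = 0`. [cite: Balaban1987RG1, (1.7) p.261 (bookkeeping)] -/
theorem Localizes17All.eventuallyAgree {S : (K : ℕ) → ClusterTower (F.P K) 𝔸 M} {emb : ReadingMaps F 𝔄 𝔸} {ℰ : TermFamily1 F 𝔄}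
    (h : Localizes17All F S emb ℰ) : EventuallyAgree F ℰ (localizedSum F S emb) :=
  fun k hist => ⟨0, fun K _ => h k hist K⟩

/-- ★ The law gives eventual agreement of `ℰ` with the localized sum (from `K₀ = k + 1` at level `k`). [cite: Balaban1987RG1, (1.7) p.261 and (1.21) p.264] -/
theorem Localizes17.eventuallyAgree {S : (K : ℕ) → ClusterTower (F.P K) 𝔸 M} {emb : ReadingMaps F 𝔄 𝔸} {ℰ : TermFamily1 F 𝔄}
    (h : Localizes17 F S emb ℰ) : EventuallyAgree F ℰ (localizedSum F S emb) :=
  fun k hist => ⟨k + 1, fun K hK => h k hist K hK⟩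

end Object

/-! ## §3. Estimate-free transfer to node U3's kernel objects -/

section Transfer

variable {𝔄 : Type*} [NormedRing 𝔄] [NormedAlgebra ℝ 𝔄]
variable {V : Type*} [NormedAddCommGroup V] [NormedSpace ℝ V] {ι : Type*} [Fintype ι]
variable (F : T4Family) (ρ : V →L[ℝ] 𝔄) (bV : Module.Basis ι ℝ V)

/-- **`polLimit` OF EVENTUALLY EQUAL FAMILIES AGREE**: the tree's (1.21) `Node00.polLimit` is a `limUnder atTop` over the run length `K`, and
two `K`-families equal from some `K₀` on have the same image filter along `atTop` (`Filter.map_congr`), hence the same `limUnder` — whether or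
not the limit exists; NO convergence is used. [cite: Balaban1987RG1, (1.21) p.264] -/
theorem polLimit_congr_of_eventually (j : ℕ) (ℰ ℰ' : (K : ℕ) → (Fin (F.P K).d → Site (F.P K) j → 𝔄) → ℝ)
    (h : ∃ K₀, ∀ K, K₀ ≤ K → ℰ K = ℰ' K) : polLimit F j ℰ ρ bV = polLimit F j ℰ' ρ bV := by
  obtain ⟨K₀, hK⟩ := h
  funext μ ν z
  unfold polLimit
  have hev : (fun K : ℕ => polWindow F K j (ℰ K) ρ bV μ ν z) =ᶠ[atTop] (fun K : ℕ => polWindow F K j (ℰ' K) ρ bV μ ν z) :=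
    Filter.eventually_atTop.2 ⟨K₀, fun K hKK => by simp only [hK K hKK]⟩
  show lim (Filter.map _ atTop) = lim (Filter.map _ atTop)
  rw [Filter.map_congr hev]

/-- Run A's limiting kernels of eventually-agreeing term families agree. [cite: Balaban1987RG1, (1.21) p.264 (bookkeeping)] -/
theorem kernelA_congr_of_eventuallyAgree {ℰ ℰ' : TermFamily1 F 𝔄} (h : EventuallyAgree F ℰ ℰ') (g : ℕ → ℝ) (k : ℕ) :
    U3OfKernels.kernelA F ℰ ρ bV g k = U3OfKernels.kernelA F ℰ' ρ bV g k := by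
  rw [U3OfKernels.kernelA_eq, U3OfKernels.kernelA_eq]
  exact polLimit_congr_of_eventually F ρ bV (k + 1) _ _ (h k (U3OfKernels.histPrefix g k))

/-- Run B's re-indexed limiting kernels of eventually-agreeing term families agree. [cite: Balaban1987RG1, (1.21) p.264 (bookkeeping)] -/
theorem kernelB_congr_of_eventuallyAgree {ℰ ℰ' : TermFamily1 F 𝔄} (h : EventuallyAgree F ℰ ℰ') (b : ℝ) (g : ℕ → ℝ) (k : ℕ) :
    U3OfKernels.kernelB F ℰ ρ bV b g k = U3OfKernels.kernelB F ℰ' ρ bV b g k := by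
  rw [U3OfKernels.kernelB_eq, U3OfKernels.kernelB_eq]
  exact kernelA_congr_of_eventuallyAgree F ρ bV h _ _

/-- Node U3's run-A level functional of eventually-agreeing term families agree. [cite: Balaban1987RG1, (1.20)–(1.22) p.264 (bookkeeping)] -/
theorem EA_congr_of_eventuallyAgree {ℰ ℰ' : TermFamily1 F 𝔄} (h : EventuallyAgree F ℰ ℰ') :
    U3OfKernels.EA F ℰ ρ bV = U3OfKernels.EA F ℰ' ρ bV := by
  funext g u p
  rw [U3OfKernels.EA_apply, U3OfKernels.EA_apply, kernelA_congr_of_eventuallyAgree F ρ bV h]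

/-- Node U3's run-B level functional of eventually-agreeing term families agree. [cite: Balaban1987RG1, (1.20)–(1.22) p.264 (bookkeeping)] -/
theorem EB_congr_of_eventuallyAgree {ℰ ℰ' : TermFamily1 F 𝔄} (h : EventuallyAgree F ℰ ℰ') :
    U3OfKernels.EB F ℰ ρ bV = U3OfKernels.EB F ℰ' ρ bV := by
  funext b g u p
  rw [U3OfKernels.EB_apply, U3OfKernels.EB_apply, kernelB_congr_of_eventuallyAgree F ρ bV h]

/-- **NODE U3's KERNEL OBJECTS OF EVENTUALLY-AGREEING TERM FAMILIES ARE EQUAL** (same carriers, same letters, equal level functionals).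
[cite: Balaban1987RG1, (1.20)–(1.22) p.264; Balaban1988RG2Cluster, (2.14) p.15] -/
theorem objects_congr_of_eventuallyAgree {ℰ ℰ' : TermFamily1 F 𝔄} (h : EventuallyAgree F ℰ ℰ') (ℓ : U3Letters₁₁) :
    U3OfKernels.objects F ℰ ρ bV ℓ = U3OfKernels.objects F ℰ' ρ bV ℓ := by
  simp only [U3OfKernels.objects, EA_congr_of_eventuallyAgree F ρ bV h, EB_congr_of_eventuallyAgree F ρ bV h]

/-- W1-19's (5.10)-class run-A binder transfers between eventually-agreeing term families. [cite: Balaban1987RG1, (5.10) p.293 and (1.21) p.264 (bookkeeping)] -/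
theorem kernelDecay_iff_of_eventuallyAgree {ℰ ℰ' : TermFamily1 F 𝔄} (h : EventuallyAgree F ℰ ℰ') (W : Set (ℕ → ℝ)) (μ ν : Fin 4) (κ : ℝ) :
    U3OfKernels.KernelDecay F ℰ ρ bV W μ ν κ ↔ U3OfKernels.KernelDecay F ℰ' ρ bV W μ ν κ := by
  rw [U3OfKernels.kernelDecay_iff, U3OfKernels.kernelDecay_iff, EA_congr_of_eventuallyAgree F ρ bV h]

/-- W1-19's (5.10)-class run-B binder transfers between eventually-agreeing term families. [cite: Balaban1987RG1, (5.10) p.293 and (1.21) p.264 (bookkeeping)] -/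
theorem kernelDecayB_iff_of_eventuallyAgree {ℰ ℰ' : TermFamily1 F 𝔄} (h : EventuallyAgree F ℰ ℰ') (W : Set (ℕ → ℝ)) (γ : ℝ) (μ ν : Fin 4)
    (κ : ℝ) : U3OfKernels.KernelDecayB F ℰ ρ bV W γ μ ν κ ↔ U3OfKernels.KernelDecayB F ℰ' ρ bV W γ μ ν κ := by
  rw [U3OfKernels.kernelDecayB_iff, U3OfKernels.kernelDecayB_iff, EB_congr_of_eventuallyAgree F ρ bV h]

variable {𝔸 : Type*} {M : ℕ}

/-- ★ **UNDER THE LAW, NODE U3's KERNEL OBJECTS OF `ℰ` ARE THE KERNEL OBJECTS OF THE READING's LOCALIZED SUM.**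
[cite: Balaban1987RG1, (1.7) p.261 and (1.20)–(1.22) p.264; Balaban1988RG2Cluster, (2.14) p.15] -/
theorem objects_eq_objects_localizedSum_of (S : (K : ℕ) → ClusterTower (F.P K) 𝔸 M) (emb : ReadingMaps F 𝔄 𝔸)
    {ℰ : TermFamily1 F 𝔄} (h : Localizes17 F S emb ℰ) (ℓ : U3Letters₁₁) :
    U3OfKernels.objects F ℰ ρ bV ℓ = U3OfKernels.objects F (localizedSum F S emb) ρ bV ℓ :=
  objects_congr_of_eventuallyAgree F ρ bV (h.eventuallyAgree F) ℓ

/-- Under the law, every PREDICATE of node U3's objects transfers between the kernel objects of `ℰ` and those of the localized sum.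
[cite: Balaban1987RG1, (1.7) p.261 and (1.20)–(1.22) p.264 (bookkeeping)] -/
theorem iff_of_localizes17 (S : (K : ℕ) → ClusterTower (F.P K) 𝔸 M) (emb : ReadingMaps F 𝔄 𝔸) {ℰ : TermFamily1 F 𝔄}
    (h : Localizes17 F S emb ℰ) (ℓ : U3Letters₁₁) (P : U3Objects₁₁ → Prop) :
    P (U3OfKernels.objects F ℰ ρ bV ℓ) ↔ P (U3OfKernels.objects F (localizedSum F S emb) ρ bV ℓ) := by
  rw [objects_eq_objects_localizedSum_of F ρ bV S emb h ℓ]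

/-- **THE FINITE-VOLUME DICTIONARY** (rfl-grade): run A's level-`k` kernel of the localized sum at the coupling sequence `g` is the tree's
(1.21)-limit `Node00.polLimit` over the run length `K` of the windowed kernels of `W ↦ Σ_{X ∈ 𝐃_{k+1}(T_K)} Re E^{(k+1)}(X; g_0, …, g_k; emb W)`
— the polarized X-sum of W1-14's history functional `W1.functionalC` over the scale-`(k+1)` fibre: print's «This limit exists by the localized
representation (1.7)» as a DEFINITIONAL identity (existence not claimed). [cite: Balaban1987RG1, (1.7) p.261 and (1.21) p.264; Balaban1988RG2Cluster, (2.14) p.15] -/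
theorem kernelA_localizedSum (S : (K : ℕ) → ClusterTower (F.P K) 𝔸 M) (emb : ReadingMaps F 𝔄 𝔸) (g : ℕ → ℝ) (k : ℕ) :
    U3OfKernels.kernelA F (localizedSum F S emb) ρ bV g k =
      polLimit F (k + 1) (fun K W => ∑ X : (domSys (F.P K) M (k + 1)).Dom, (functionalC (S K) g (emb K k W) ⟨k + 1, X⟩).re) ρ bV := rfl

/-- The same with W1's terms displayed (`W1.ClusterStep.E` at the cut history). [cite: Balaban1987RG1, (1.7) p.261 and (1.21) p.264 (bookkeeping)] -/
theorem kernelA_localizedSum_eq_polLimit_sum_E (S : (K : ℕ) → ClusterTower (F.P K) 𝔸 M) (emb : ReadingMaps F 𝔄 𝔸) (g : ℕ → ℝ) (k : ℕ) :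
    U3OfKernels.kernelA F (localizedSum F S emb) ρ bV g k =
      polLimit F (k + 1) (fun K W => ∑ X : (domSys (F.P K) M (k + 1)).Dom,
        (((S K) k).E (U3OfKernels.histPrefix g k) (emb K k W) X).re) ρ bV := rfl

/-- Under the law, run A's limiting kernel of `ℰ` IS the (1.21)-limit of the polarized localized sums of the reading.
[cite: Balaban1987RG1, (1.7) p.261 and (1.21) p.264] -/
theorem kernelA_eq_polLimit_localizedSum_of (S : (K : ℕ) → ClusterTower (F.P K) 𝔸 M) (emb : ReadingMaps F 𝔄 𝔸) {ℰ : TermFamily1 F 𝔄}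
    (h : Localizes17 F S emb ℰ) (g : ℕ → ℝ) (k : ℕ) :
    U3OfKernels.kernelA F ℰ ρ bV g k =
      polLimit F (k + 1) (fun K W => ∑ X : (domSys (F.P K) M (k + 1)).Dom, (functionalC (S K) g (emb K k W) ⟨k + 1, X⟩).re) ρ bV := by
  rw [kernelA_congr_of_eventuallyAgree F ρ bV (h.eventuallyAgree F) g k]; rfl

end Transfer

/-! ## §4. At the record, Stage 13 -/

section Record

open scoped Matrix.Norms.L2Operator

variable (F : T4Family) (N : ℕ) [NeZero N] {𝔸 : Type*} {M : ℕ}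

/-- **THE LAW AT THE RECORD**: the MERGED TERM FAMILY OF RECORD `mergedTermFamilyMatT F N (TβOfRecord₁₃ F N) (chiβOfRecord₁₃ F N θ) θ.εbg`
(the (1.6) merged new term read through the β-layer transport and the (2.9) species of record, `Node00/Record13`) IS the localized sum of the
reading's towers `S` through `emb`.  DISPLAYED HYPOTHESIS; its inhabitant is the content of the cluster expansion of the RG-defined actions
([II] Lemmas 1–3 with [I] §1) — nobody's theorem today. [cite: Balaban1987RG1, (1.7) p.261 and (1.6) p.261; Balaban1988RG2Cluster, (2.14) p.15] -/
def Localizes17OfRecord₁₃ (θ : Stage13Params F N) (S : (K : ℕ) → ClusterTower (F.P K) 𝔸 M) (emb : ReadingMaps F (MatA N) 𝔸) : Prop :=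
  Localizes17 F S emb (mergedTermFamilyMatT F N (TβOfRecord₁₃ F N) (chiβOfRecord₁₃ F N θ) θ.εbg)

/-- Face (`Iff.rfl`). [cite: Balaban1987RG1, (1.7) p.261 (bookkeeping)] -/
theorem localizes17OfRecord₁₃_iff (θ : Stage13Params F N) (S : (K : ℕ) → ClusterTower (F.P K) 𝔸 M) (emb : ReadingMaps F (MatA N) 𝔸) :
    Localizes17OfRecord₁₃ F N θ S emb ↔
      Localizes17 F S emb (mergedTermFamilyMatT F N (TβOfRecord₁₃ F N) (chiβOfRecord₁₃ F N θ) θ.εbg) := Iff.rfl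

/-- **NODE U3's KERNEL OBJECTS OF THE W1 READING AT THE RECORD's β-CHART**: `U3OfKernels.objects` at the localized sum of the towers `S`
through `emb`, probe `θ.ρ8`, basis `θ.bV` (instances bound by `letI` exactly as in `U3OfKernels.objectsOfRecord₁₃`), letter block `ℓ`.
[cite: Balaban1987RG1, (1.7) p.261 and (1.20)–(1.22) p.264; Balaban1988RG2Cluster, (2.14) p.15] -/
noncomputable def objectsOfReading₁₃ (θ : Stage13Params F N) (S : (K : ℕ) → ClusterTower (F.P K) 𝔸 M) (emb : ReadingMaps F (MatA N) 𝔸)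
    (ℓ : U3Letters₁₁) : U3Objects₁₁ :=
  letI := θ.instVβ₁; letI := θ.instVβ₂; letI := θ.instιβ
  U3OfKernels.objects F (localizedSum F S emb) θ.ρ8 θ.bV ℓ

/-- Face (`rfl`): the level carriers are W1-19's kernel carrier. [cite: Balaban1987RG1, (1.20)–(1.22) p.264 (bookkeeping)] -/
@[simp] theorem objectsOfReading₁₃_levelCarriers (θ : Stage13Params F N) (S : (K : ℕ) → ClusterTower (F.P K) 𝔸 M)
    (emb : ReadingMaps F (MatA N) 𝔸) (ℓ : U3Letters₁₁) (k : ℕ) :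
    (objectsOfReading₁₃ F N θ S emb ℓ).levelCarriers k = U3OfKernels.carriers := rfl

/-- Face (`rfl`): the letter block. [cite: Balaban1987RG1, (1.20)–(1.22) p.264 (bookkeeping)] -/
@[simp] theorem objectsOfReading₁₃_toU3Letters₁₁ (θ : Stage13Params F N) (S : (K : ℕ) → ClusterTower (F.P K) 𝔸 M)
    (emb : ReadingMaps F (MatA N) 𝔸) (ℓ : U3Letters₁₁) : (objectsOfReading₁₃ F N θ S emb ℓ).toU3Letters₁₁ = ℓ := rfl

/-- The kernel objects of the reading are POPULATED. [cite: Balaban1987RG1, (0.24)–(0.25) p.257 (bookkeeping)] -/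
theorem objectsOfReading₁₃_populated (θ : Stage13Params F N) (S : (K : ℕ) → ClusterTower (F.P K) 𝔸 M)
    (emb : ReadingMaps F (MatA N) 𝔸) (ℓ : U3Letters₁₁) : (objectsOfReading₁₃ F N θ S emb ℓ).Populated := by
  letI := θ.instVβ₁; letI := θ.instVβ₂; letI := θ.instιβ
  exact U3OfKernels.objects_populated F _ θ.ρ8 θ.bV ℓ

/-- ★★ **UNDER THE LAW AT THE RECORD, NODE U3's OBJECTS OF RECORD ARE THE KERNEL OBJECTS OF THE W1 READING.**
[cite: Balaban1987RG1, (1.7) p.261 and (1.20)–(1.22) p.264; Balaban1988RG2Cluster, (2.14) p.15] -/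
theorem objectsOfRecord₁₃_eq_objects_localizedSum_of (θ : Stage13Params F N) (S : (K : ℕ) → ClusterTower (F.P K) 𝔸 M)
    (emb : ReadingMaps F (MatA N) 𝔸) (h : Localizes17OfRecord₁₃ F N θ S emb) (ℓ : U3Letters₁₁) :
    U3OfKernels.objectsOfRecord₁₃ F N θ ℓ = objectsOfReading₁₃ F N θ S emb ℓ := by
  letI := θ.instVβ₁; letI := θ.instVβ₂; letI := θ.instιβ
  show U3OfKernels.objects F _ θ.ρ8 θ.bV ℓ = U3OfKernels.objects F _ θ.ρ8 θ.bV ℓ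
  exact objects_eq_objects_localizedSum_of F θ.ρ8 θ.bV S emb h ℓ

/-- ★★ **EVERY PREDICATE OF NODE U3's OBJECTS TRANSFERS** under the law at the record: a slot ∕ guard ∕ read-out clause holds at the objects of
record iff it holds at the kernel objects of the reading (the Summit side's `N22At ∕ N18At ∕ ReadOutAt ∕ SensitiveOnBoxes ∕ KeyedLive …` are
such predicates). [cite: Balaban1987RG1, (1.7) p.261 and (1.20)–(1.22) p.264 (bookkeeping)] -/
theorem iff_of_localizes17OfRecord₁₃ (θ : Stage13Params F N) (S : (K : ℕ) → ClusterTower (F.P K) 𝔸 M) (emb : ReadingMaps F (MatA N) 𝔸)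
    (h : Localizes17OfRecord₁₃ F N θ S emb) (ℓ : U3Letters₁₁) (P : U3Objects₁₁ → Prop) :
    P (U3OfKernels.objectsOfRecord₁₃ F N θ ℓ) ↔ P (objectsOfReading₁₃ F N θ S emb ℓ) := by
  rw [objectsOfRecord₁₃_eq_objects_localizedSum_of F N θ S emb h ℓ]

/-- The (D4) letter of record — W1-19's (5.10) binder `U3OfKernels.KernelDecayOfRecord₁₃` — read at the reading under the law: it is the
(5.10)-class binder of the LOCALIZED SUM's limiting kernels on the window of record. [cite: Balaban1987RG1, (5.10) p.293, (1.7) p.261 and (1.21) p.264] -/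
theorem kernelDecayOfRecord₁₃_iff_of_localizes (θ : Stage13Params F N) (S : (K : ℕ) → ClusterTower (F.P K) 𝔸 M)
    (emb : ReadingMaps F (MatA N) 𝔸) (h : Localizes17OfRecord₁₃ F N θ S emb) (μ ν : Fin 4) (κ : ℝ) :
    U3OfKernels.KernelDecayOfRecord₁₃ F N θ μ ν κ ↔
      (letI := θ.instVβ₁; letI := θ.instVβ₂; letI := θ.instιβ
       U3OfKernels.KernelDecay F (localizedSum F S emb) θ.ρ8 θ.bV (Window θ.γ) μ ν κ) := by
  letI := θ.instVβ₁; letI := θ.instVβ₂; letI := θ.instιβ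
  exact kernelDecay_iff_of_eventuallyAgree F θ.ρ8 θ.bV (h.eventuallyAgree F) (Window θ.γ) μ ν κ

end Record

end Literature.MathematicalPhysics.QuantumFieldTheory.Balaban1983to89.Node00.LocalizedSum17
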